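import Mathlib
import HarnessLib
import Summits.ValiantsHypothesis.ValiantsHypothesis.Theorems.LacunarySymmetroidMatrixDescartesOsculationLawUniformMultichoose

/-!
# ValiantsHypothesis / LacunarySymmetroid — crux `MatrixDescartes` (stmt-ValiantsHypothesis-18050, V1), line «osculation-law»:
# the LAW's inequality OFF THE WINDOW `log₂ m < K < 20 m²`, and for every BOUNDED number of letters

The line `Cruxes/MatrixDescartes/Lines/osculation_law.lean` asks for
`OsculationLaw : ∃ C, ∀ m K, OsculationLawAt m K (2 ^ (C * (K + Nat.log 2 m ^ 2)))` (its last `sorry`, `stub_osculationLaw`).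
The landed all-format Descartes rung `OsculationUniformRung.osculationLawAt_all_multichoose`
(`OsculationLawAt m K (m * Nat.multichoose K (20 * m ^ 2))`, p640643, val-lit-p5 g12) already implies the LAW's inequality,
with the explicit constant `C = 11`, whenever `K ≤ log₂ m` (few letters: `multichoose K n ≤ (K + n) ^ K ≤ 2 ^ ((2 log₂ m + 7) K)`)
or `20 m² ≤ K` (many letters: `multichoose K n ≤ 2 ^ (K + n - 1) ≤ 2 ^ (2 K)`) — `osculationLawAt_offWindow` — and, with a
constant depending on `K₀` only, whenever `K ≤ K₀` — `osculationLawAt_of_le` (the LAW for every bounded number of letters,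
all formats `m` at once).  So the OPEN content of `stub_osculationLaw` is exactly the window
«`m → ∞` and `K → ∞` jointly with `log₂ m < K < 20 m²`» (see `…OsculationLawWindowReduction` for the formal reduction).
This makes val-lit-p5 g12's calibration memo `HOME/lmr/NOTE-p5g12-18050-LAW-calibration.md` kernel-checked.

Statements are the line's `OsculationLawAt` body UNFOLDED verbatim (token-for-token as in `osculationLawAt_all_multichoose`),
so the line file can cite them by name with δ-unfolding only.

HONEST FRAMING: ℕ-arithmetic corollaries of a Descartes ceiling; NOT `stub_osculationLaw` (whose content is the window),
not `MatrixDescartes`, not Conjecture B; `VP ≠ VNP` is NOT proved.  No definitions, no named facts; Mathlib + one tree file.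
-/

-- `Summit.ValiantsHypothesis.ValiantsHypothesis.…` is the tree's mandated single-conjunct layout (Sub = Summit).
set_option linter.dupNamespace false

set_option maxRecDepth 100000

namespace Summit.ValiantsHypothesis.ValiantsHypothesis.Theorems.LacunarySymmetroidMatrixDescartes

open scoped BigOperators

namespace OsculationWindow

/-! ### Arithmetic of the budget `m · multichoose K (20 m²)` against `2 ^ (C (K + log₂² m))` -/

/-- `multichoose K n = C(K + n − 1, n) ≤ 2 ^ (K + n)`. [folklore] -/
theorem multichoose_le_two_pow (K n : ℕ) : Nat.multichoose K n ≤ 2 ^ (K + n) := by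
  rw [Nat.multichoose_eq]
  exact (Nat.choose_le_two_pow _ _).trans (Nat.pow_le_pow_right (by norm_num) (by omega))

/-- `multichoose K n = C(K + n − 1, K − 1) ≤ (K + n) ^ K`. [folklore] -/
theorem multichoose_le_pow (K n : ℕ) : Nat.multichoose K n ≤ (K + n) ^ K := by
  rcases Nat.eq_zero_or_pos K with rfl | hK
  · cases n with
    | zero => simp [Nat.multichoose_zero_right]
    | succ n => simp [Nat.multichoose_zero_succ]
  · rw [Nat.multichoose_eq]
    have h1 : (K + n - 1).choose n = (K + n - 1).choose (K - 1) := by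
      rw [← Nat.choose_symm (show n ≤ K + n - 1 by omega)]
      congr 1
      omega
    rw [h1]
    calc (K + n - 1).choose (K - 1) ≤ (K + n - 1) ^ (K - 1) := Nat.choose_le_pow _ _
      _ ≤ (K + n) ^ (K - 1) := Nat.pow_le_pow_left (by omega) _
      _ ≤ (K + n) ^ K := Nat.pow_le_pow_right (by omega) (by omega)

/-- MANY letters: `20 m² ≤ K` ⇒ `m · multichoose K (20 m²) ≤ 2 ^ (3 K)`. [folklore] -/
theorem large_window (m K : ℕ) (h : 20 * m ^ 2 ≤ K) :
    m * Nat.multichoose K (20 * m ^ 2) ≤ 2 ^ (3 * K) := by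
  have hm : m ≤ 2 ^ K := by
    have h1 : m ≤ 20 * m ^ 2 := by nlinarith
    exact (h1.trans h).trans Nat.lt_two_pow_self.le
  have hmc : Nat.multichoose K (20 * m ^ 2) ≤ 2 ^ (2 * K) :=
    (multichoose_le_two_pow _ _).trans (Nat.pow_le_pow_right (by norm_num) (by omega))
  calc m * Nat.multichoose K (20 * m ^ 2) ≤ 2 ^ K * 2 ^ (2 * K) := Nat.mul_le_mul hm hmc
    _ = 2 ^ (3 * K) := by rw [← pow_add]; congr 1; ring

/-- FEW letters: `K ≤ log₂ m` ⇒ `m · multichoose K (20 m²) ≤ 2 ^ (11 (log₂ m)²)`. [folklore] -/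
theorem small_window (m K : ℕ) (h : K ≤ Nat.log 2 m) :
    m * Nat.multichoose K (20 * m ^ 2) ≤ 2 ^ (11 * Nat.log 2 m ^ 2) := by
  rcases Nat.eq_zero_or_pos K with hK0 | hK
  · subst hK0
    rcases Nat.eq_zero_or_pos m with hm0 | hm
    · subst hm0
      simp
    · have h20 : 20 * m ^ 2 = (20 * m ^ 2 - 1) + 1 := by
        have : 1 ≤ 20 * m ^ 2 := by nlinarith
        omega
      rw [h20, Nat.multichoose_zero_succ, mul_zero]
      exact Nat.zero_le _
  · have hL1 : 1 ≤ Nat.log 2 m := by omega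
    have hm : m < 2 ^ (Nat.log 2 m + 1) := Nat.lt_pow_succ_log_self (by norm_num) m
    have hm2 : m ^ 2 < 2 ^ (2 * Nat.log 2 m + 2) := by
      calc m ^ 2 < (2 ^ (Nat.log 2 m + 1)) ^ 2 := Nat.pow_lt_pow_left hm two_ne_zero
        _ = 2 ^ (2 * Nat.log 2 m + 2) := by rw [← pow_mul]; congr 1; ring
    have hLX : Nat.log 2 m ≤ 2 ^ (2 * Nat.log 2 m + 2) :=
      Nat.lt_two_pow_self.le.trans (Nat.pow_le_pow_right (by norm_num) (by omega))
    have hKn : K + 20 * m ^ 2 ≤ 2 ^ (2 * Nat.log 2 m + 7) := by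
      have e : (2 : ℕ) ^ (2 * Nat.log 2 m + 7) = 2 ^ (2 * Nat.log 2 m + 2) * 32 := by
        rw [show 2 * Nat.log 2 m + 7 = (2 * Nat.log 2 m + 2) + 5 by ring, pow_add]
        norm_num
      rw [e]
      generalize 2 ^ (2 * Nat.log 2 m + 2) = X at hm2 hLX ⊢
      generalize m ^ 2 = M at hm2 ⊢
      omega
    have hpow : Nat.multichoose K (20 * m ^ 2) ≤ 2 ^ (9 * Nat.log 2 m ^ 2) := by
      calc Nat.multichoose K (20 * m ^ 2) ≤ (K + 20 * m ^ 2) ^ K := multichoose_le_pow _ _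
        _ ≤ (2 ^ (2 * Nat.log 2 m + 7)) ^ K := Nat.pow_le_pow_left hKn _
        _ = 2 ^ ((2 * Nat.log 2 m + 7) * K) := by rw [← pow_mul]
        _ ≤ 2 ^ ((2 * Nat.log 2 m + 7) * Nat.log 2 m) :=
            Nat.pow_le_pow_right (by norm_num) (Nat.mul_le_mul_left _ h)
        _ ≤ 2 ^ (9 * Nat.log 2 m ^ 2) := Nat.pow_le_pow_right (by norm_num) (by nlinarith)
    have hm' : m ≤ 2 ^ (2 * Nat.log 2 m ^ 2) :=
      hm.le.trans (Nat.pow_le_pow_right (by norm_num) (by nlinarith))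
    calc m * Nat.multichoose K (20 * m ^ 2) ≤ 2 ^ (2 * Nat.log 2 m ^ 2) * 2 ^ (9 * Nat.log 2 m ^ 2) :=
          Nat.mul_le_mul hm' hpow
      _ = 2 ^ (11 * Nat.log 2 m ^ 2) := by rw [← pow_add]; congr 1; ring

/-- OFF THE WINDOW: `K ≤ log₂ m ∨ 20 m² ≤ K` ⇒ `m · multichoose K (20 m²) ≤ 2 ^ (11 (K + log₂² m))`. [folklore] -/
theorem window_arith (m K : ℕ) (h : K ≤ Nat.log 2 m ∨ 20 * m ^ 2 ≤ K) :
    m * Nat.multichoose K (20 * m ^ 2) ≤ 2 ^ (11 * (K + Nat.log 2 m ^ 2)) := by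
  rcases h with h | h
  · exact (small_window m K h).trans (Nat.pow_le_pow_right (by norm_num) (by nlinarith))
  · exact (large_window m K h).trans (Nat.pow_le_pow_right (by norm_num) (by nlinarith [Nat.zero_le (Nat.log 2 m ^ 2)]))

/-- BOUNDED number of letters: `K ≤ K₀` ⇒ `m · multichoose K (20 m²) ≤ 2 ^ ((11 + 2 K₀ + 20·4^K₀) (K + log₂² m))`, for every
format `m` (few letters by `small_window`; otherwise `m < 2 ^ (log₂ m + 1) ≤ 2 ^ K₀` bounds everything by a constant). [folklore] -/
theorem bounded_arith (K₀ m K : ℕ) (hK : K ≤ K₀) :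
    m * Nat.multichoose K (20 * m ^ 2) ≤ 2 ^ ((11 + 2 * K₀ + 20 * 4 ^ K₀) * (K + Nat.log 2 m ^ 2)) := by
  by_cases hKL : K ≤ Nat.log 2 m
  · exact (small_window m K hKL).trans (Nat.pow_le_pow_right (by norm_num)
      (by nlinarith [Nat.zero_le (4 ^ K₀), Nat.zero_le K₀, Nat.zero_le K]))
  · push Not at hKL
    have hK1 : 1 ≤ K := by omega
    have hm : m < 2 ^ (Nat.log 2 m + 1) := Nat.lt_pow_succ_log_self (by norm_num) m
    have hmK : m < 2 ^ K₀ := lt_of_lt_of_le hm (Nat.pow_le_pow_right (by norm_num) (by omega))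
    have hm2 : m ^ 2 < 4 ^ K₀ := by
      calc m ^ 2 < (2 ^ K₀) ^ 2 := Nat.pow_lt_pow_left hmK two_ne_zero
        _ = 4 ^ K₀ := by rw [← pow_mul, mul_comm, pow_mul]; norm_num
    have hmc : Nat.multichoose K (20 * m ^ 2) ≤ 2 ^ (K₀ + 20 * 4 ^ K₀) := by
      refine (multichoose_le_two_pow _ _).trans (Nat.pow_le_pow_right (by norm_num) ?_)
      generalize 4 ^ K₀ = Y at hm2 ⊢
      generalize m ^ 2 = M at hm2 ⊢
      omega
    calc m * Nat.multichoose K (20 * m ^ 2) ≤ 2 ^ K₀ * 2 ^ (K₀ + 20 * 4 ^ K₀) := Nat.mul_le_mul hmK.le hmc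
      _ = 2 ^ (2 * K₀ + 20 * 4 ^ K₀) := by rw [← pow_add]; congr 1; ring
      _ ≤ 2 ^ ((11 + 2 * K₀ + 20 * 4 ^ K₀) * (K + Nat.log 2 m ^ 2)) :=
          Nat.pow_le_pow_right (by norm_num)
            (by nlinarith [hK1, Nat.zero_le (4 ^ K₀), Nat.zero_le (Nat.log 2 m ^ 2), Nat.zero_le K₀])

/-! ### The LAW's inequality off the window and for bounded `K` (line vocabulary unfolded verbatim) -/

/-- **OFF THE WINDOW** — for `K ≤ log₂ m` or `20 m² ≤ K`, `OsculationLawAt m K (2 ^ (11 * (K + Nat.log 2 m ^ 2)))`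
(the line's `OsculationLawAt` UNFOLDED verbatim): the LAW's inequality with the explicit constant `C = 11` holds at every
format outside the window `log₂ m < K < 20 m²`.  Descartes ceiling `osculationLawAt_all_multichoose` + `window_arith`. -/
theorem osculationLawAt_offWindow (m K : ℕ) (hw : K ≤ Nat.log 2 m ∨ 20 * m ^ 2 ≤ K) :
    ∀ (r s : ℕ), r + s = m → ∀ (d : Fin K → ℕ) (S : Fin K → Matrix (Fin r ⊕ Fin s) (Fin r ⊕ Fin s) ℝ),
      (∀ l, (S l).IsSymm) →
      {p : Fin 2 → ℝ | 0 < p 0 ∧ 0 < p 1 ∧ MvPolynomial.eval p (∑ l, (MvPolynomial.X (0 : Fin 2) : MvPolynomial (Fin 2) ℝ) ^ d l •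
              (S l).map (MvPolynomial.C : ℝ →+* MvPolynomial (Fin 2) ℝ)
            + (MvPolynomial.X (1 : Fin 2) : MvPolynomial (Fin 2) ℝ) •
              (Matrix.fromBlocks 1 0 0 0 : Matrix (Fin r ⊕ Fin s) (Fin r ⊕ Fin s) ℝ).map
                (MvPolynomial.C : ℝ →+* MvPolynomial (Fin 2) ℝ)).det = 0 ∧
      MvPolynomial.eval p
        (MvPolynomial.X 0 * MvPolynomial.pderiv 0 (MvPolynomial.X 0 * MvPolynomial.pderiv 0 (∑ l, (MvPolynomial.X (0 : Fin 2) : MvPolynomial (Fin 2) ℝ) ^ d l •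
              (S l).map (MvPolynomial.C : ℝ →+* MvPolynomial (Fin 2) ℝ)
            + (MvPolynomial.X (1 : Fin 2) : MvPolynomial (Fin 2) ℝ) •
              (Matrix.fromBlocks 1 0 0 0 : Matrix (Fin r ⊕ Fin s) (Fin r ⊕ Fin s) ℝ).map
                (MvPolynomial.C : ℝ →+* MvPolynomial (Fin 2) ℝ)).det)
            * (MvPolynomial.X 1 * MvPolynomial.pderiv 1 (∑ l, (MvPolynomial.X (0 : Fin 2) : MvPolynomial (Fin 2) ℝ) ^ d l •
              (S l).map (MvPolynomial.C : ℝ →+* MvPolynomial (Fin 2) ℝ)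
            + (MvPolynomial.X (1 : Fin 2) : MvPolynomial (Fin 2) ℝ) •
              (Matrix.fromBlocks 1 0 0 0 : Matrix (Fin r ⊕ Fin s) (Fin r ⊕ Fin s) ℝ).map
                (MvPolynomial.C : ℝ →+* MvPolynomial (Fin 2) ℝ)).det) ^ 2
          - 2 * (MvPolynomial.X 0 * MvPolynomial.pderiv 0 (MvPolynomial.X 1 * MvPolynomial.pderiv 1 (∑ l, (MvPolynomial.X (0 : Fin 2) : MvPolynomial (Fin 2) ℝ) ^ d l •
              (S l).map (MvPolynomial.C : ℝ →+* MvPolynomial (Fin 2) ℝ)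
            + (MvPolynomial.X (1 : Fin 2) : MvPolynomial (Fin 2) ℝ) •
              (Matrix.fromBlocks 1 0 0 0 : Matrix (Fin r ⊕ Fin s) (Fin r ⊕ Fin s) ℝ).map
                (MvPolynomial.C : ℝ →+* MvPolynomial (Fin 2) ℝ)).det))
            * (MvPolynomial.X 0 * MvPolynomial.pderiv 0 (∑ l, (MvPolynomial.X (0 : Fin 2) : MvPolynomial (Fin 2) ℝ) ^ d l •
              (S l).map (MvPolynomial.C : ℝ →+* MvPolynomial (Fin 2) ℝ)
            + (MvPolynomial.X (1 : Fin 2) : MvPolynomial (Fin 2) ℝ) •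
              (Matrix.fromBlocks 1 0 0 0 : Matrix (Fin r ⊕ Fin s) (Fin r ⊕ Fin s) ℝ).map
                (MvPolynomial.C : ℝ →+* MvPolynomial (Fin 2) ℝ)).det) * (MvPolynomial.X 1 * MvPolynomial.pderiv 1 (∑ l, (MvPolynomial.X (0 : Fin 2) : MvPolynomial (Fin 2) ℝ) ^ d l •
              (S l).map (MvPolynomial.C : ℝ →+* MvPolynomial (Fin 2) ℝ)
            + (MvPolynomial.X (1 : Fin 2) : MvPolynomial (Fin 2) ℝ) •
              (Matrix.fromBlocks 1 0 0 0 : Matrix (Fin r ⊕ Fin s) (Fin r ⊕ Fin s) ℝ).map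
                (MvPolynomial.C : ℝ →+* MvPolynomial (Fin 2) ℝ)).det)
          + MvPolynomial.X 1 * MvPolynomial.pderiv 1 (MvPolynomial.X 1 * MvPolynomial.pderiv 1 (∑ l, (MvPolynomial.X (0 : Fin 2) : MvPolynomial (Fin 2) ℝ) ^ d l •
              (S l).map (MvPolynomial.C : ℝ →+* MvPolynomial (Fin 2) ℝ)
            + (MvPolynomial.X (1 : Fin 2) : MvPolynomial (Fin 2) ℝ) •
              (Matrix.fromBlocks 1 0 0 0 : Matrix (Fin r ⊕ Fin s) (Fin r ⊕ Fin s) ℝ).map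
                (MvPolynomial.C : ℝ →+* MvPolynomial (Fin 2) ℝ)).det)
            * (MvPolynomial.X 0 * MvPolynomial.pderiv 0 (∑ l, (MvPolynomial.X (0 : Fin 2) : MvPolynomial (Fin 2) ℝ) ^ d l •
              (S l).map (MvPolynomial.C : ℝ →+* MvPolynomial (Fin 2) ℝ)
            + (MvPolynomial.X (1 : Fin 2) : MvPolynomial (Fin 2) ℝ) •
              (Matrix.fromBlocks 1 0 0 0 : Matrix (Fin r ⊕ Fin s) (Fin r ⊕ Fin s) ℝ).map
                (MvPolynomial.C : ℝ →+* MvPolynomial (Fin 2) ℝ)).det) ^ 2) = 0}.Finite →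
      {p : Fin 2 → ℝ | 0 < p 0 ∧ 0 < p 1 ∧ MvPolynomial.eval p (∑ l, (MvPolynomial.X (0 : Fin 2) : MvPolynomial (Fin 2) ℝ) ^ d l •
              (S l).map (MvPolynomial.C : ℝ →+* MvPolynomial (Fin 2) ℝ)
            + (MvPolynomial.X (1 : Fin 2) : MvPolynomial (Fin 2) ℝ) •
              (Matrix.fromBlocks 1 0 0 0 : Matrix (Fin r ⊕ Fin s) (Fin r ⊕ Fin s) ℝ).map
                (MvPolynomial.C : ℝ →+* MvPolynomial (Fin 2) ℝ)).det = 0 ∧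
      MvPolynomial.eval p
        (MvPolynomial.X 0 * MvPolynomial.pderiv 0 (MvPolynomial.X 0 * MvPolynomial.pderiv 0 (∑ l, (MvPolynomial.X (0 : Fin 2) : MvPolynomial (Fin 2) ℝ) ^ d l •
              (S l).map (MvPolynomial.C : ℝ →+* MvPolynomial (Fin 2) ℝ)
            + (MvPolynomial.X (1 : Fin 2) : MvPolynomial (Fin 2) ℝ) •
              (Matrix.fromBlocks 1 0 0 0 : Matrix (Fin r ⊕ Fin s) (Fin r ⊕ Fin s) ℝ).map
                (MvPolynomial.C : ℝ →+* MvPolynomial (Fin 2) ℝ)).det)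
            * (MvPolynomial.X 1 * MvPolynomial.pderiv 1 (∑ l, (MvPolynomial.X (0 : Fin 2) : MvPolynomial (Fin 2) ℝ) ^ d l •
              (S l).map (MvPolynomial.C : ℝ →+* MvPolynomial (Fin 2) ℝ)
            + (MvPolynomial.X (1 : Fin 2) : MvPolynomial (Fin 2) ℝ) •
              (Matrix.fromBlocks 1 0 0 0 : Matrix (Fin r ⊕ Fin s) (Fin r ⊕ Fin s) ℝ).map
                (MvPolynomial.C : ℝ →+* MvPolynomial (Fin 2) ℝ)).det) ^ 2
          - 2 * (MvPolynomial.X 0 * MvPolynomial.pderiv 0 (MvPolynomial.X 1 * MvPolynomial.pderiv 1 (∑ l, (MvPolynomial.X (0 : Fin 2) : MvPolynomial (Fin 2) ℝ) ^ d l •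
              (S l).map (MvPolynomial.C : ℝ →+* MvPolynomial (Fin 2) ℝ)
            + (MvPolynomial.X (1 : Fin 2) : MvPolynomial (Fin 2) ℝ) •
              (Matrix.fromBlocks 1 0 0 0 : Matrix (Fin r ⊕ Fin s) (Fin r ⊕ Fin s) ℝ).map
                (MvPolynomial.C : ℝ →+* MvPolynomial (Fin 2) ℝ)).det))
            * (MvPolynomial.X 0 * MvPolynomial.pderiv 0 (∑ l, (MvPolynomial.X (0 : Fin 2) : MvPolynomial (Fin 2) ℝ) ^ d l •
              (S l).map (MvPolynomial.C : ℝ →+* MvPolynomial (Fin 2) ℝ)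
            + (MvPolynomial.X (1 : Fin 2) : MvPolynomial (Fin 2) ℝ) •
              (Matrix.fromBlocks 1 0 0 0 : Matrix (Fin r ⊕ Fin s) (Fin r ⊕ Fin s) ℝ).map
                (MvPolynomial.C : ℝ →+* MvPolynomial (Fin 2) ℝ)).det) * (MvPolynomial.X 1 * MvPolynomial.pderiv 1 (∑ l, (MvPolynomial.X (0 : Fin 2) : MvPolynomial (Fin 2) ℝ) ^ d l •
              (S l).map (MvPolynomial.C : ℝ →+* MvPolynomial (Fin 2) ℝ)
            + (MvPolynomial.X (1 : Fin 2) : MvPolynomial (Fin 2) ℝ) •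
              (Matrix.fromBlocks 1 0 0 0 : Matrix (Fin r ⊕ Fin s) (Fin r ⊕ Fin s) ℝ).map
                (MvPolynomial.C : ℝ →+* MvPolynomial (Fin 2) ℝ)).det)
          + MvPolynomial.X 1 * MvPolynomial.pderiv 1 (MvPolynomial.X 1 * MvPolynomial.pderiv 1 (∑ l, (MvPolynomial.X (0 : Fin 2) : MvPolynomial (Fin 2) ℝ) ^ d l •
              (S l).map (MvPolynomial.C : ℝ →+* MvPolynomial (Fin 2) ℝ)
            + (MvPolynomial.X (1 : Fin 2) : MvPolynomial (Fin 2) ℝ) •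
              (Matrix.fromBlocks 1 0 0 0 : Matrix (Fin r ⊕ Fin s) (Fin r ⊕ Fin s) ℝ).map
                (MvPolynomial.C : ℝ →+* MvPolynomial (Fin 2) ℝ)).det)
            * (MvPolynomial.X 0 * MvPolynomial.pderiv 0 (∑ l, (MvPolynomial.X (0 : Fin 2) : MvPolynomial (Fin 2) ℝ) ^ d l •
              (S l).map (MvPolynomial.C : ℝ →+* MvPolynomial (Fin 2) ℝ)
            + (MvPolynomial.X (1 : Fin 2) : MvPolynomial (Fin 2) ℝ) •
              (Matrix.fromBlocks 1 0 0 0 : Matrix (Fin r ⊕ Fin s) (Fin r ⊕ Fin s) ℝ).map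
                (MvPolynomial.C : ℝ →+* MvPolynomial (Fin 2) ℝ)).det) ^ 2) = 0}.ncard ≤ 2 ^ (11 * (K + Nat.log 2 m ^ 2)) := by
  intro r s hrs d S hS hfin
  exact (OsculationUniformRung.osculationLawAt_all_multichoose m K r s hrs d S hS hfin).trans (window_arith m K hw)

/-- **BOUNDED NUMBER OF LETTERS** — for every `K₀`, every format `m` and every `K ≤ K₀`,
`OsculationLawAt m K (2 ^ ((11 + 2 * K₀ + 20 * 4 ^ K₀) * (K + Nat.log 2 m ^ 2)))` (UNFOLDED verbatim): the LAW restricted to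
pencils with at most `K₀` letters holds with a constant depending on `K₀` alone.  (So the LAW's open content needs `K → ∞`.) -/
theorem osculationLawAt_of_le (K₀ m K : ℕ) (hK : K ≤ K₀) :
    ∀ (r s : ℕ), r + s = m → ∀ (d : Fin K → ℕ) (S : Fin K → Matrix (Fin r ⊕ Fin s) (Fin r ⊕ Fin s) ℝ),
      (∀ l, (S l).IsSymm) →
      {p : Fin 2 → ℝ | 0 < p 0 ∧ 0 < p 1 ∧ MvPolynomial.eval p (∑ l, (MvPolynomial.X (0 : Fin 2) : MvPolynomial (Fin 2) ℝ) ^ d l •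
              (S l).map (MvPolynomial.C : ℝ →+* MvPolynomial (Fin 2) ℝ)
            + (MvPolynomial.X (1 : Fin 2) : MvPolynomial (Fin 2) ℝ) •
              (Matrix.fromBlocks 1 0 0 0 : Matrix (Fin r ⊕ Fin s) (Fin r ⊕ Fin s) ℝ).map
                (MvPolynomial.C : ℝ →+* MvPolynomial (Fin 2) ℝ)).det = 0 ∧
      MvPolynomial.eval p
        (MvPolynomial.X 0 * MvPolynomial.pderiv 0 (MvPolynomial.X 0 * MvPolynomial.pderiv 0 (∑ l, (MvPolynomial.X (0 : Fin 2) : MvPolynomial (Fin 2) ℝ) ^ d l •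
              (S l).map (MvPolynomial.C : ℝ →+* MvPolynomial (Fin 2) ℝ)
            + (MvPolynomial.X (1 : Fin 2) : MvPolynomial (Fin 2) ℝ) •
              (Matrix.fromBlocks 1 0 0 0 : Matrix (Fin r ⊕ Fin s) (Fin r ⊕ Fin s) ℝ).map
                (MvPolynomial.C : ℝ →+* MvPolynomial (Fin 2) ℝ)).det)
            * (MvPolynomial.X 1 * MvPolynomial.pderiv 1 (∑ l, (MvPolynomial.X (0 : Fin 2) : MvPolynomial (Fin 2) ℝ) ^ d l •
              (S l).map (MvPolynomial.C : ℝ →+* MvPolynomial (Fin 2) ℝ)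
            + (MvPolynomial.X (1 : Fin 2) : MvPolynomial (Fin 2) ℝ) •
              (Matrix.fromBlocks 1 0 0 0 : Matrix (Fin r ⊕ Fin s) (Fin r ⊕ Fin s) ℝ).map
                (MvPolynomial.C : ℝ →+* MvPolynomial (Fin 2) ℝ)).det) ^ 2
          - 2 * (MvPolynomial.X 0 * MvPolynomial.pderiv 0 (MvPolynomial.X 1 * MvPolynomial.pderiv 1 (∑ l, (MvPolynomial.X (0 : Fin 2) : MvPolynomial (Fin 2) ℝ) ^ d l •
              (S l).map (MvPolynomial.C : ℝ →+* MvPolynomial (Fin 2) ℝ)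
            + (MvPolynomial.X (1 : Fin 2) : MvPolynomial (Fin 2) ℝ) •
              (Matrix.fromBlocks 1 0 0 0 : Matrix (Fin r ⊕ Fin s) (Fin r ⊕ Fin s) ℝ).map
                (MvPolynomial.C : ℝ →+* MvPolynomial (Fin 2) ℝ)).det))
            * (MvPolynomial.X 0 * MvPolynomial.pderiv 0 (∑ l, (MvPolynomial.X (0 : Fin 2) : MvPolynomial (Fin 2) ℝ) ^ d l •
              (S l).map (MvPolynomial.C : ℝ →+* MvPolynomial (Fin 2) ℝ)
            + (MvPolynomial.X (1 : Fin 2) : MvPolynomial (Fin 2) ℝ) •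
              (Matrix.fromBlocks 1 0 0 0 : Matrix (Fin r ⊕ Fin s) (Fin r ⊕ Fin s) ℝ).map
                (MvPolynomial.C : ℝ →+* MvPolynomial (Fin 2) ℝ)).det) * (MvPolynomial.X 1 * MvPolynomial.pderiv 1 (∑ l, (MvPolynomial.X (0 : Fin 2) : MvPolynomial (Fin 2) ℝ) ^ d l •
              (S l).map (MvPolynomial.C : ℝ →+* MvPolynomial (Fin 2) ℝ)
            + (MvPolynomial.X (1 : Fin 2) : MvPolynomial (Fin 2) ℝ) •
              (Matrix.fromBlocks 1 0 0 0 : Matrix (Fin r ⊕ Fin s) (Fin r ⊕ Fin s) ℝ).map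
                (MvPolynomial.C : ℝ →+* MvPolynomial (Fin 2) ℝ)).det)
          + MvPolynomial.X 1 * MvPolynomial.pderiv 1 (MvPolynomial.X 1 * MvPolynomial.pderiv 1 (∑ l, (MvPolynomial.X (0 : Fin 2) : MvPolynomial (Fin 2) ℝ) ^ d l •
              (S l).map (MvPolynomial.C : ℝ →+* MvPolynomial (Fin 2) ℝ)
            + (MvPolynomial.X (1 : Fin 2) : MvPolynomial (Fin 2) ℝ) •
              (Matrix.fromBlocks 1 0 0 0 : Matrix (Fin r ⊕ Fin s) (Fin r ⊕ Fin s) ℝ).map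
                (MvPolynomial.C : ℝ →+* MvPolynomial (Fin 2) ℝ)).det)
            * (MvPolynomial.X 0 * MvPolynomial.pderiv 0 (∑ l, (MvPolynomial.X (0 : Fin 2) : MvPolynomial (Fin 2) ℝ) ^ d l •
              (S l).map (MvPolynomial.C : ℝ →+* MvPolynomial (Fin 2) ℝ)
            + (MvPolynomial.X (1 : Fin 2) : MvPolynomial (Fin 2) ℝ) •
              (Matrix.fromBlocks 1 0 0 0 : Matrix (Fin r ⊕ Fin s) (Fin r ⊕ Fin s) ℝ).map
                (MvPolynomial.C : ℝ →+* MvPolynomial (Fin 2) ℝ)).det) ^ 2) = 0}.Finite →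
      {p : Fin 2 → ℝ | 0 < p 0 ∧ 0 < p 1 ∧ MvPolynomial.eval p (∑ l, (MvPolynomial.X (0 : Fin 2) : MvPolynomial (Fin 2) ℝ) ^ d l •
              (S l).map (MvPolynomial.C : ℝ →+* MvPolynomial (Fin 2) ℝ)
            + (MvPolynomial.X (1 : Fin 2) : MvPolynomial (Fin 2) ℝ) •
              (Matrix.fromBlocks 1 0 0 0 : Matrix (Fin r ⊕ Fin s) (Fin r ⊕ Fin s) ℝ).map
                (MvPolynomial.C : ℝ →+* MvPolynomial (Fin 2) ℝ)).det = 0 ∧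
      MvPolynomial.eval p
        (MvPolynomial.X 0 * MvPolynomial.pderiv 0 (MvPolynomial.X 0 * MvPolynomial.pderiv 0 (∑ l, (MvPolynomial.X (0 : Fin 2) : MvPolynomial (Fin 2) ℝ) ^ d l •
              (S l).map (MvPolynomial.C : ℝ →+* MvPolynomial (Fin 2) ℝ)
            + (MvPolynomial.X (1 : Fin 2) : MvPolynomial (Fin 2) ℝ) •
              (Matrix.fromBlocks 1 0 0 0 : Matrix (Fin r ⊕ Fin s) (Fin r ⊕ Fin s) ℝ).map
                (MvPolynomial.C : ℝ →+* MvPolynomial (Fin 2) ℝ)).det)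
            * (MvPolynomial.X 1 * MvPolynomial.pderiv 1 (∑ l, (MvPolynomial.X (0 : Fin 2) : MvPolynomial (Fin 2) ℝ) ^ d l •
              (S l).map (MvPolynomial.C : ℝ →+* MvPolynomial (Fin 2) ℝ)
            + (MvPolynomial.X (1 : Fin 2) : MvPolynomial (Fin 2) ℝ) •
              (Matrix.fromBlocks 1 0 0 0 : Matrix (Fin r ⊕ Fin s) (Fin r ⊕ Fin s) ℝ).map
                (MvPolynomial.C : ℝ →+* MvPolynomial (Fin 2) ℝ)).det) ^ 2
          - 2 * (MvPolynomial.X 0 * MvPolynomial.pderiv 0 (MvPolynomial.X 1 * MvPolynomial.pderiv 1 (∑ l, (MvPolynomial.X (0 : Fin 2) : MvPolynomial (Fin 2) ℝ) ^ d l •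
              (S l).map (MvPolynomial.C : ℝ →+* MvPolynomial (Fin 2) ℝ)
            + (MvPolynomial.X (1 : Fin 2) : MvPolynomial (Fin 2) ℝ) •
              (Matrix.fromBlocks 1 0 0 0 : Matrix (Fin r ⊕ Fin s) (Fin r ⊕ Fin s) ℝ).map
                (MvPolynomial.C : ℝ →+* MvPolynomial (Fin 2) ℝ)).det))
            * (MvPolynomial.X 0 * MvPolynomial.pderiv 0 (∑ l, (MvPolynomial.X (0 : Fin 2) : MvPolynomial (Fin 2) ℝ) ^ d l •
              (S l).map (MvPolynomial.C : ℝ →+* MvPolynomial (Fin 2) ℝ)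
            + (MvPolynomial.X (1 : Fin 2) : MvPolynomial (Fin 2) ℝ) •
              (Matrix.fromBlocks 1 0 0 0 : Matrix (Fin r ⊕ Fin s) (Fin r ⊕ Fin s) ℝ).map
                (MvPolynomial.C : ℝ →+* MvPolynomial (Fin 2) ℝ)).det) * (MvPolynomial.X 1 * MvPolynomial.pderiv 1 (∑ l, (MvPolynomial.X (0 : Fin 2) : MvPolynomial (Fin 2) ℝ) ^ d l •
              (S l).map (MvPolynomial.C : ℝ →+* MvPolynomial (Fin 2) ℝ)
            + (MvPolynomial.X (1 : Fin 2) : MvPolynomial (Fin 2) ℝ) •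
              (Matrix.fromBlocks 1 0 0 0 : Matrix (Fin r ⊕ Fin s) (Fin r ⊕ Fin s) ℝ).map
                (MvPolynomial.C : ℝ →+* MvPolynomial (Fin 2) ℝ)).det)
          + MvPolynomial.X 1 * MvPolynomial.pderiv 1 (MvPolynomial.X 1 * MvPolynomial.pderiv 1 (∑ l, (MvPolynomial.X (0 : Fin 2) : MvPolynomial (Fin 2) ℝ) ^ d l •
              (S l).map (MvPolynomial.C : ℝ →+* MvPolynomial (Fin 2) ℝ)
            + (MvPolynomial.X (1 : Fin 2) : MvPolynomial (Fin 2) ℝ) •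
              (Matrix.fromBlocks 1 0 0 0 : Matrix (Fin r ⊕ Fin s) (Fin r ⊕ Fin s) ℝ).map
                (MvPolynomial.C : ℝ →+* MvPolynomial (Fin 2) ℝ)).det)
            * (MvPolynomial.X 0 * MvPolynomial.pderiv 0 (∑ l, (MvPolynomial.X (0 : Fin 2) : MvPolynomial (Fin 2) ℝ) ^ d l •
              (S l).map (MvPolynomial.C : ℝ →+* MvPolynomial (Fin 2) ℝ)
            + (MvPolynomial.X (1 : Fin 2) : MvPolynomial (Fin 2) ℝ) •
              (Matrix.fromBlocks 1 0 0 0 : Matrix (Fin r ⊕ Fin s) (Fin r ⊕ Fin s) ℝ).map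
                (MvPolynomial.C : ℝ →+* MvPolynomial (Fin 2) ℝ)).det) ^ 2) = 0}.ncard ≤ 2 ^ ((11 + 2 * K₀ + 20 * 4 ^ K₀) * (K + Nat.log 2 m ^ 2)) := by
  intro r s hrs d S hS hfin
  exact (OsculationUniformRung.osculationLawAt_all_multichoose m K r s hrs d S hS hfin).trans (bounded_arith K₀ m K hK)

end OsculationWindow

end Summit.ValiantsHypothesis.ValiantsHypothesis.Theorems.LacunarySymmetroidMatrixDescartes
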